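import Summits.HodgeConjecture.HodgeConjecture.Theses.DworkReflectionQuotients
import Literature.AlgebraicGeometry.HodgeTheory.DworkSexticHodgeClassesModuloInvariants

/-!
# Route `DworkReflectionQuotients`: the leaf `DworkSexticHodge` from crux K1, `DworkOtherCodimensions`
# and the algebraicity of the `Γ_W`-INVARIANT Hodge classes at a very general `ψ` alone

Route `route-HodgeConjecture-DworkReflectionQuotients` (cell `hodge-nonav`; FRONTIER rung F-H1 — never summit
credit), items `stmt-HodgeConjecture-20240` (crux K1 `ReflectionQuotientDescent`) and
`stmt-HodgeConjecture-20243` (support `GenericHodgeClassesFlat`). Prover seat `hodge-nonav-20241-p1` (g8),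
2026-08-28. SUPPORT FILE (`--supports`): no item is closed here; the theorems take the route decls
`ReflectionQuotientDescent` (open, in tree modulo the named fact
`DworkSextic.BiniGarbagnati2012_reflectionQuotient_smoothProjective_rcc`) and `DworkOtherCodimensions` (proved)
as HYPOTHESES, together with ONE explicit hypothesis on the `Γ_W`-invariant part of `H⁴`.

STRUCTURAL OBSERVATION (the Literature theorem
`DworkSextic.mem_algebraicClasses_of_reflInvariant_of_invariant`, file
`Literature/AlgebraicGeometry/HodgeTheory/DworkSexticHodgeClassesModuloInvariants`): for EVERY `ψ⁶ ≠ 1` and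
every rational `(2,2)`-class `c` on `X_ψ`, `c − π₁ c` (`π₁` = projector onto the `Γ_W`-invariants) is a
`ℂ`-combination of reflection-invariant rational `(2,2)`-classes — the six-reflection averaging of
`DworkSexticReflectionAveraging` applies to every NON-TRIVIAL character block of `Γ_W`, flat or not, because
the Hodge classes of `X_ψ` at the given `ψ` form a `Γ_W`-stable `ℚ`-subspace whose isotypic components are
again Hodge classes. Consequences proved here:

* `mem_algebraicClasses_two_of_reflectionQuotientDescent_of_invariant` — granted K1, at any `ψ⁶ ≠ 1` at
  which the `Γ_W`-invariant rational `(2,2)`-classes are algebraic, ALL rational `(2,2)`-classes of `X_ψ`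
  are algebraic; `hodgeConjectureFor_of_reflectionQuotientDescent_of_invariant` — with
  `DworkOtherCodimensions`, `HodgeConjectureFor 4 X_ψ` at such `ψ`;
* `dworkSexticHodge_of_reflectionQuotientDescent_of_genericInvariant` — **the rung leaf
  `DworkPrymHodge.DworkSexticHodge` follows from K1 + `DworkOtherCodimensions` + «off a countable set of
  `ψ`, every `Γ_W`-invariant rational `(2,2)`-class on `X_ψ` is algebraic»** — an assembly in which crux
  K2 `FlatClassesSpannedByReflectionInvariants` (proved anyway) and the support `GenericHodgeClassesFlat`
  (Katz 2009 Thm. 5.3 + Cattani–Deligne–Kaplan on ALL character blocks) are replaced by a statement about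
  the rank-`6` invariant piece `ℚh² ⊕ H[0]` only (the cohomology of the mirror; for very general `ψ` its
  Hodge classes are `ℚh²` by the infinitesimal Noether–Lefschetz argument on a rank-`5` variation with
  Hodge numbers `(1,1,1,1,1)`);
* `genericHodgeClassesFlat_of_reflectionQuotientDescent_of_genericInvariant` — the support item
  `GenericHodgeClassesFlat` itself follows from K1 and that generic-invariant statement (with `c₀ = c`,
  `w = 0`).

Honest framing: conditional theorems (hypotheses = an open crux and an unfiled statement); nothing here
says HC, HC_CM or HC_AV is proved; rung F-H1 not moved.

## References

* N. M. Katz, *Another look at the Dwork family*, Progr. Math. 270 (2009), §2–§3, Lemma 3.1, Thm. 5.3.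
  [Katz2009]
* G. Bini, A. Garbagnati, *Quotients of the Dwork pencil*, J. Geom. Phys. 75 (2014), §3.4, Prop. 3.20.
  [BiniGarbagnati2012]
* C. Voisin, *Hodge Theory and Complex Algebraic Geometry II* (2003), §5.3 (Cor. 5.17), §6.1–6.2.
  [VoisinHodgeII2003]
-/

namespace Summit.HodgeConjecture.HodgeConjecture.Theorems

open Literature.AlgebraicGeometry.HodgeTheory Literature.AlgebraicGeometry.Motives
open Literature.AlgebraicTopology.SingularHomology
open scoped BigOperators

/-- **All rational `(2,2)`-classes of `X_ψ` are algebraic, granted K1 and the invariant part.** Let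
`ψ⁶ ≠ 1`. If `ReflectionQuotientDescent` holds (crux K1 of the route: reflection-invariant rational
`(2,2)`-classes are algebraic) and every `Γ_W`-invariant rational `(2,2)`-class on `X_ψ` (`g^* c = c` for
every realised diagonal symmetry `a ∈ μ₆⁶`, `∏ aᵢ = 1`) is algebraic, then every rational `(2,2)`-class
`c ∈ H⁴(X_ψ(ℂ); ℂ)` lies in `algebraicClasses X_ψ 2`
(`DworkSextic.mem_algebraicClasses_of_reflInvariant_of_invariant`). [cite: Katz2009, §3]
[cite: BiniGarbagnati2012, §3.4] -/
theorem mem_algebraicClasses_two_of_reflectionQuotientDescent_of_invariant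
    (h1 : Summit.HodgeConjecture.HodgeConjecture.Theses.DworkReflectionQuotients.ReflectionQuotientDescent)
    {ψ : ℂ} (hψ : ψ ^ 6 ≠ 1)
    (hinv : ∀ c : complexBetti (DworkSextic.fibre ψ) (2 * 2), IsRationalClass c →
      IsOfHodgeType 4 (DworkSextic.fibre ψ) (2 * 2) 2 2 c →
      (∀ a : Fin 6 → ℂ, (∀ i, a i ^ 6 = 1) → ∏ i, a i = 1 →
        ∀ g : C(ComplexPoints (DworkSextic.fibre ψ), ComplexPoints (DworkSextic.fibre ψ)),
          (∀ x, ∃ t : ℂ, (DworkSextic.pt ψ (g x)).rep = t • (a * (DworkSextic.pt ψ x).rep)) →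
          singularCohomology.map ℂ ℂ g (2 * 2) c = c) →
      c ∈ algebraicClasses (DworkSextic.fibre ψ) 2)
    {c : complexBetti (DworkSextic.fibre ψ) (2 * 2)} (hrat : IsRationalClass c)
    (hhodge : IsOfHodgeType 4 (DworkSextic.fibre ψ) (2 * 2) 2 2 c) :
    c ∈ algebraicClasses (DworkSextic.fibre ψ) 2 := by
  refine DworkSextic.mem_algebraicClasses_of_reflInvariant_of_invariant hψ ?_ ?_ hrat hhodge
  · rintro x hxrat hxhodge ⟨i, i', hii', ζ, hζ, g, hg, hfix⟩
    exact h1 ψ hψ i i' hii' ζ hζ g hg x hxrat hxhodge hfix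
  · intro x hxrat hxhodge hx
    refine hinv x hxrat hxhodge fun a ha hprod g hg => ?_
    rw [hx a ha hprod g hg]
    simp only [pow_zero, Finset.prod_const_one, one_smul]

/-- **`HodgeConjectureFor 4 X_ψ` at every `ψ⁶ ≠ 1` at which the `Γ_W`-invariant rational `(2,2)`-classes
are algebraic**, granted K1 (`ReflectionQuotientDescent`) and `DworkOtherCodimensions` (Hodge model;
codimensions `p ≠ 2`). [cite: Katz2009, §3] [cite: BiniGarbagnati2012, §3.4 and Prop. 3.20] -/
theorem hodgeConjectureFor_of_reflectionQuotientDescent_of_invariant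
    (h1 : Summit.HodgeConjecture.HodgeConjecture.Theses.DworkReflectionQuotients.ReflectionQuotientDescent)
    (h4 : Summit.HodgeConjecture.HodgeConjecture.Theses.DworkReflectionQuotients.DworkOtherCodimensions)
    {ψ : ℂ} (hψ : ψ ^ 6 ≠ 1)
    (hinv : ∀ c : complexBetti (DworkSextic.fibre ψ) (2 * 2), IsRationalClass c →
      IsOfHodgeType 4 (DworkSextic.fibre ψ) (2 * 2) 2 2 c →
      (∀ a : Fin 6 → ℂ, (∀ i, a i ^ 6 = 1) → ∏ i, a i = 1 →
        ∀ g : C(ComplexPoints (DworkSextic.fibre ψ), ComplexPoints (DworkSextic.fibre ψ)),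
          (∀ x, ∃ t : ℂ, (DworkSextic.pt ψ (g x)).rep = t • (a * (DworkSextic.pt ψ x).rep)) →
          singularCohomology.map ℂ ℂ g (2 * 2) c = c) →
      c ∈ algebraicClasses (DworkSextic.fibre ψ) 2) :
    HodgeConjectureFor 4 (DworkSextic.fibre ψ) := by
  obtain ⟨hmodel, hother⟩ := h4 ψ hψ
  refine ⟨hmodel, fun p c hc hh => ?_⟩
  by_cases hp : p = 2
  · subst hp
    exact mem_algebraicClasses_two_of_reflectionQuotientDescent_of_invariant h1 hψ hinv hc hh
  · exact hother p hp c hc hh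

/-- The sixth roots of unity form a finite set. [folklore] -/
private theorem finite_setOf_pow_six_eq_one : {ψ : ℂ | ψ ^ 6 = 1}.Finite := by
  refine (Polynomial.nthRoots 6 (1 : ℂ)).toFinset.finite_toSet.subset ?_
  intro x hx
  simp only [Set.mem_setOf_eq] at hx
  simp [Multiset.mem_toFinset, Polynomial.mem_nthRoots, hx]

/-- **The rung leaf from K1, `DworkOtherCodimensions`, and the generic algebraicity of the INVARIANT
Hodge classes.** If `ReflectionQuotientDescent` and `DworkOtherCodimensions` hold, and off a countable set
of parameters `ψ` every `Γ_W`-invariant rational `(2,2)`-class on `X_ψ` is algebraic (spelled in the route's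
inline vocabulary; for very general `ψ` the invariant Hodge classes are expected to be `ℚh²`, the invariant
piece `ℚh² ⊕ H[0]` being a rank-`6` variation with `H[0]` of Hodge numbers `(1,1,1,1,1)`), then
`DworkPrymHodge.DworkSexticHodge` — «HC for the very general Dwork sextic fourfold», rung F-H1 — holds. An
alternative assembly of the route in which K2 and `GenericHodgeClassesFlat` do not occur. Never summit credit.
[cite: Katz2009, §3 and Lemma 3.1] [cite: BiniGarbagnati2012, Prop. 3.20] [cite: VoisinHodgeII2003, Cor. 5.17] -/
theorem dworkSexticHodge_of_reflectionQuotientDescent_of_genericInvariant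
    (h1 : Summit.HodgeConjecture.HodgeConjecture.Theses.DworkReflectionQuotients.ReflectionQuotientDescent)
    (h4 : Summit.HodgeConjecture.HodgeConjecture.Theses.DworkReflectionQuotients.DworkOtherCodimensions)
    (hgen : ∃ S : Set ℂ, S.Countable ∧ ∀ ψ : ℂ, ψ ∉ S → ψ ^ 6 ≠ 1 →
      let F : MvPolynomial (Fin 6) ℂ := (∑ i, MvPolynomial.X i ^ 6) - MvPolynomial.C (6 * ψ) * ∏ i, MvPolynomial.X i
      let X := Literature.AlgebraicGeometry.Motives.SmoothHypersurface.hypersurface F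
      let pt := Literature.AlgebraicGeometry.HodgeTheory.hypersurfacePoint
        (Literature.AlgebraicGeometry.Motives.SmoothHypersurface.hypersurfaceι F)
      ∀ c : complexBetti X (2 * 2), IsRationalClass c → IsOfHodgeType 4 X (2 * 2) 2 2 c →
        (∀ a : Fin 6 → ℂ, (∀ i, a i ^ 6 = 1) → ∏ i, a i = 1 →
          ∀ g : C(ComplexPoints X, ComplexPoints X),
            (∀ x, ∃ t : ℂ, (pt (g x)).rep = t • (a * (pt x).rep)) →
            singularCohomology.map ℂ ℂ g (2 * 2) c = c) →
        c ∈ algebraicClasses X 2) :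
    Summit.HodgeConjecture.HodgeConjecture.Theses.DworkPrymHodge.DworkSexticHodge := by
  obtain ⟨S, hS, hgen⟩ := hgen
  refine ⟨S ∪ {ψ : ℂ | ψ ^ 6 = 1}, hS.union finite_setOf_pow_six_eq_one.countable, ?_⟩
  intro ψ hψ
  simp only [Set.mem_union, Set.mem_setOf_eq, not_or] at hψ
  obtain ⟨hψS, hψ6⟩ := hψ
  exact hodgeConjectureFor_of_reflectionQuotientDescent_of_invariant h1 h4 hψ6 (hgen ψ hψS hψ6)

/-- **The support item `GenericHodgeClassesFlat` from K1 and the generic algebraicity of the invariant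
Hodge classes**: off the countable set, every rational `(2,2)`-class `c` is itself algebraic
(`mem_algebraicClasses_two_of_reflectionQuotientDescent_of_invariant`), so the required decomposition holds
with `c₀ = c` and all flat summands `w_{j,σ} = 0 = 0 + 0`. [cite: Katz2009, §3 and Thm. 5.3]
[cite: BiniGarbagnati2012, §3.4] -/
theorem genericHodgeClassesFlat_of_reflectionQuotientDescent_of_genericInvariant
    (h1 : Summit.HodgeConjecture.HodgeConjecture.Theses.DworkReflectionQuotients.ReflectionQuotientDescent)
    (hgen : ∃ S : Set ℂ, S.Countable ∧ ∀ ψ : ℂ, ψ ∉ S → ψ ^ 6 ≠ 1 →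
      let F : MvPolynomial (Fin 6) ℂ := (∑ i, MvPolynomial.X i ^ 6) - MvPolynomial.C (6 * ψ) * ∏ i, MvPolynomial.X i
      let X := Literature.AlgebraicGeometry.Motives.SmoothHypersurface.hypersurface F
      let pt := Literature.AlgebraicGeometry.HodgeTheory.hypersurfacePoint
        (Literature.AlgebraicGeometry.Motives.SmoothHypersurface.hypersurfaceι F)
      ∀ c : complexBetti X (2 * 2), IsRationalClass c → IsOfHodgeType 4 X (2 * 2) 2 2 c →
        (∀ a : Fin 6 → ℂ, (∀ i, a i ^ 6 = 1) → ∏ i, a i = 1 →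
          ∀ g : C(ComplexPoints X, ComplexPoints X),
            (∀ x, ∃ t : ℂ, (pt (g x)).rep = t • (a * (pt x).rep)) →
            singularCohomology.map ℂ ℂ g (2 * 2) c = c) →
        c ∈ algebraicClasses X 2) :
    Summit.HodgeConjecture.HodgeConjecture.Theses.DworkReflectionQuotients.GenericHodgeClassesFlat := by
  obtain ⟨S, hS, hgen⟩ := hgen
  refine ⟨S ∪ {ψ : ℂ | ψ ^ 6 = 1}, hS.union finite_setOf_pow_six_eq_one.countable, ?_⟩
  intro ψ hψ
  simp only [Set.mem_union, Set.mem_setOf_eq, not_or] at hψ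
  obtain ⟨hψS, hψ6⟩ := hψ
  intro F X pt IsEig c hc hh
  refine ⟨c, fun _ _ => 0,
    mem_algebraicClasses_two_of_reflectionQuotientDescent_of_invariant h1 hψ6 (hgen ψ hψS hψ6) hc hh,
    fun j σ => ⟨IsRationalClass.zero, 0, 0, ?_, ?_, (add_zero _).symm⟩, ?_⟩
  · intro a _ _ g _
    rw [map_zero, smul_zero]
  · intro a _ _ g _
    rw [map_zero, smul_zero]
  · simp only [Finset.sum_const_zero, add_zero]

end Summit.HodgeConjecture.HodgeConjecture.Theorems
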